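import Mathlib
import Literature.MathematicalPhysics.QuantumFieldTheory.Balaban1983to89.B14DomainGeom

/-!
# `Balaban1983to89.B16PostRGeom` — [Balaban1989LargeFieldII] pp. 378–379, 390: the cube-layer GEOMETRY behind the
leading characteristic function of (1.72) and the new large-field region (1.101) after the 𝐑-operation, KERNEL-CHECKED
as finite set algebra (cell `GAPS.md` row G-B16-15; adv4's "cheapest check" C-adv4-14; bears on G-adv3-8 / G-f2.4)

CITATION HEADER (lean-in-tree rule 2026-08-18).  Source: T. Bałaban, *Large field renormalization. II. Localization,
exponentiation, and bounds for the 𝐑 operation*, Commun. Math. Phys. **122**, 355–392 (1989) [Balaban1989LargeFieldII]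
(cell paper B16 = [IV]'s sequel; held `paper:balaban1989-cmp122-large-field-ii`, journal page = PDF page + 354;
quotations read on the x2 renders `b2b-balaban-ref1/pages/1989-cmp122-large-field-II/…-p024/p025/p036/p037/p038-x2.png`).
The inductive hypothesis referred to is [Balaban1988Convergent] (= [III], cell paper B14) Sect. 2, pp. 254–257
(renders `…/1988-cmp119-convergent-renormalization/…-p012/p013/p014/p015-x2.png`); the small large-field components `Z`
are those of [Balaban1989LargeFieldI] (= [IV], cell paper B15) p. 177.  The layer operations `X~ⁿ` / `X~⁻ⁿ` are the
sup-metric cube layers of [Balaban1987RG1] p. 257 (prose definition of □̃ⁿ, no display number) as typed in the sibling module `…B14DomainGeom` (`enl`,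
`innerN`).  The papers are manuscripts UNDER ADJUDICATION by the audit cell `pub-balaban`: NOTHING printed in them is
asserted here; every `theorem` below is finite set algebra on `ℤᵈ`, proved without `sorry` and without new axioms.  NEW
sibling module of unit `b2b-balaban-b02` (gen 3); it imports `…B14DomainGeom` (unit pv02) and modifies nothing.
v1.1 (gen 6, DOCFIX `GAPS.md` G-pv10-5 after the cross-read C-pv10-19): docstring-only page-locator corrections — (2.3)
is on [III] p. 255 [PDF 13]; the (1.101)/(2.18) quotation runs over pp. 390–391; the layer notation `X~ⁿ` is [I] p. 257's
prose definition (there is no display for it); [III] p. 256 is quoted with its misprint marked; declarations byte-identical to v1.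

THE PRINTED TEXT.  B16 p. 378 [PDF 24]: *"Now we try to remove the characteristic functions χ_{k,Λ}χ. We introduce the
decompositions of unity  1 = χ_k((Ω_k^{~4})ᶜ) + χ_k^c((Ω_k^{~4})ᶜ)  in components of Z. The components with the
second, large field function are included again into the large field domain of the new action … Thus, the components
of Z are divided into two classes. For components of the first class, denoted by {X₁,…,X_n}, there are only the
characteristic functions χ_k(X_i^{~-6}), which are combined with the function χ_k(Ω_k^{~4}), here Ω_k is the old k-th
domain. … For the components of the second class, denoted by {Y₁,…,Y_m}, we have the large field characteristic
functions χ_k^c(Y_i^{~-6}), and the previous functions χ_{k,Λ_i}χ_i together with the δ-functions δ_{G_i}(V_k′), where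
Λ_i = Λ ∩ Y_i, G_i = G₀ ∩ Y_i."*  p. 379 [PDF 25], (1.72): *"(𝐑ρ_k)(V_k) = Σ_{Z_k} Σ_{{Y₁,…,Y_m}}
χ_k((Ω_k ∩ (Y₁ᶜ)^{~2} ∩ ⋯ ∩ (Y_mᶜ)^{~2})^{~4}) · (Σ_{{Ω_jᶜ,Z_j}} 𝐓_k″(Z_k)) exp A_k′(…) ·
Π_{i=1}^m χ_k^c(Y_i^{~-6}) χ_{k,Λ_i} χ_i δ_{G_i}(V_k′) 𝐓_k′(Y_i) · {Σ_{n≥0} Σ_{{X₁,…,X_n}} Π_{j=1}^n 𝐓_k′(X_j) exp Σ_Y V(Y,U_k)},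
where Ω_k is the new k-th domain defined by the determining set of the configuration U_k."*  pp. 390–391 [PDF 36–37]: *"The new
large field region is equal to Z_k ∪ ⋃_{i=1}^m Y_i, and the operation 𝐓_k for a component Y of the set ⋃ Y_i has the
form (1.102) … it follows that the result 𝐑ρ_k of the 𝐑-operation can be written in the form (2.18) [III], with all the
expressions satisfying the induction hypothesis described in Sect. 2 [III]."*  [III] p. 254 (2.1): *"Ω₁ ⊃ Λ₁ ⊃ Ω₂ ⊃ Λ₂
⊃ … ⊃ Ω_k ⊃ Λ_k"*; p. 255: *"we admit the possibility that Λ_j = Ω_j for some indices j. Such a situation may arise as a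
result of an 𝐑-operation"*; p. 256: *"The domains Ω_j, Λ_j, which are determined by he [sic] j-th renormalization
transformation, but not by the 𝐑-operation, are unions of MR_j-cubes in the lattice T_{L^{-j}}. They satisfy also other
conditions, e.g., the distance between their boundaries is at least equal to 2MR_j"*; (2.3) p. 255: *"Z_j = Λ_jᶜ … if a
component of Z_j is contained in a cube of the size 100MR_j …, then it is a rectangular parallelepiped"*.  [IV] p. 177:
*"Each term in the expansion (2.18) [III] has a large field region Λ_kᶜ. It is a union of connected components. … Let us
denote the union of the above class of components by Z."*

READING (declared, not printed).  All sets are point sets of ONE lattice `Pt d = ℤᵈ` partitioned into cubes of side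
`s` (the cube family in terms of which `Ω_k`, the components of `Z` and the `~`-operations of pp. 378–379 are defined —
[III] p. 245: *"Usually this operation applied to other sets means adding one layer of cubes taken from this family of
cubes, in terms of which the sets are defined"*; WHICH family (MR_k- or LM₂R_k-cubes) is not fixed by pp. 378–379 and is
not needed below); `X~ⁿ = enl s n X`, `X~⁻ⁿ = innerN s n X`, `(Yᶜ)~² = enl s 2 Yᶜ`.  `Ω` = the OLD k-th domain, `X j`
= the class-1 components, `Y i` = the class-2 components, `Z = ⋃ X j ∪ ⋃ Y i`, `Λ` = the old `Λ_k` (`Z ⊆ Λᶜ`).  The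
standard local picture "`Λ_k = Ω_k~⁻²` near a whole, isolated component `X` of `Λ_kᶜ`" ([III] (3.20) p. 269) is TYPED as
the hypothesis `LocalCollar s Ω X : Ωᶜ ∩ X~⁴ = X~⁻²` (§C; it tolerates other pieces of `Ωᶜ` at ≥ 2 layers from `X`,
i.e. exactly the printed 2MR_j separation, since 4 = 2 + 2; §F derives it for a rectangular parallelepiped core).

WHAT IS PROVED (all unconditional set algebra unless a hypothesis is displayed).
* §A layer supplements: `(X~⁻ᵇ)~⁻ᵃ = X~⁻⁽ᵃ⁺ᵇ⁾` (`innerN_innerN`), `((X~⁻ᵇ)ᶜ)~ᵃ = (X~⁻⁽ᵃ⁺ᵇ⁾)ᶜ` (`enl_compl_innerN`),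
  `~` over arbitrary unions (`enl_iUnion`).
* §B for ANY candidate new domain `Ωnew`: the printed leading domain `(Ωnew ∩ ⋂ᵢ (Y iᶜ)~²)~⁴` is DISJOINT from every
  `Y i~⁻⁶` (`leadingDomain_disjoint_innerN6`), and `((Yᶜ)~²)~⁴ = (Y~⁻⁶)ᶜ` (`enl4_enl2_compl`): the new small-field
  leading domain stops exactly at the boundary of the retained large-field support `Y_i~⁻⁶`, with the standard collar
  width 4 + 2 = 6.
* §C under `LocalCollar s Ω X`: `(Ω~⁴)ᶜ ∩ X = X~⁻⁶` (`LocalCollar.compl_enl4_inter`) — the identity the print uses when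
  it rewrites `χ_k((Ω_k~⁴)ᶜ)` on a class-1 component as `χ_k(X_i~⁻⁶)`; `X~⁴ ⊆ Ω~⁴ ∪ X`; `X \ X~⁻² ⊆ Ω`.
* §D THE EFFECTIVE NEW k-TH DOMAIN.  `(Ω ∪ ⋃ⱼ X j)~⁴ = Ω~⁴ ∪ ⋃ⱼ X j~⁻⁶` (`leading_support_eq`, a disjoint union by
  `LocalCollar.disjoint_enl4_innerN6`) — the region of *"χ_k(X_i~⁻⁶) … combined with the function χ_k(Ω_k~⁴)"*; and
  READING INVARIANCE: both candidate readings of *"the new k-th domain"* — (A) `Ω ∪ ⋃ⱼ X j` (class-1 components filled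
  in) and (B) `Ω ∪ Z` (all small components filled in, the class-2 interiors then removed by the printed cut
  `⋂ᵢ (Y iᶜ)~²`) — give the SAME set after the printed cut, namely `Ω′ := Ω ∪ ⋃ⱼ X j`
  (`effective_of_readingA`, `effective_of_readingB`).  Hence the leading function of (1.72) constrains exactly the
  cubes of `Ω~⁴ ∪ ⋃ⱼ X j~⁻⁶`, as p. 378 says, whichever reading of p. 379's sentence is meant.
* §E (1.101) as set algebra: with `Λ′ := Λ ∪ ⋃ⱼ X j`, `(Λ′)ᶜ = (Λᶜ ∩ Zᶜ) ∪ ⋃ᵢ Y i` (`compl_newLambda_eq`: the printed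
  *"Z_k ∪ ⋃ Y_i"* with `Z_k` read as the part of the old `Λ_kᶜ` outside `Z`); `Λ′ ⊆ Ω′` from `Λ ⊆ Ω` ((2.1) at level k,
  `newLambda_subset_newOmega`); `Ω′ ∩ Y i = Ω ∩ Y i` (`newOmega_inter_Y`: the collar of every class-2 component is the
  old one, so every layer margin the old pair `(Ω_k, Λ_k)` had at `Y_i` holds verbatim for `(Ω′, Λ′)`); the new collar
  region `Ω′ ∩ Λ′ᶜ = (Ω ∩ Λᶜ) ∩ (⋃ⱼ X j)ᶜ` (`newCollar_eq`, where [III] p. 255's `S_k ⊇ Ω_k \ Ω_k~⁻¹` clause lives).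
* §F boxes: for a rectangular parallelepiped of cubes `box s lo hi`, `(box~ⁿ)~⁻ⁿ = box` (`innerN_enl_box`), hence
  `LocalCollar` holds for `X = W~²` whenever `Ωᶜ ∩ X~⁴ = W` with `W` a box (`localCollar_of_box`; (2.3) + [IV] p. 177:
  the components of `Z` are rectangular parallelepipeds).
WHAT IS *NOT* ASSERTED: what *"the new k-th domain defined by the determining set of the configuration U_k"* IS (the
print does not define it; §D shows the two natural readings agree after the printed cut); the redefinition of the
lower levels `{Ω_l, Λ_l, S_l}_{l<k}` inside `Z` after `𝐓_k′` integrates the histories (unprinted — the located residual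
of row G-B16-15); which cube family carries the `~` of pp. 378–379; anything about characteristic functions, fields,
the operations `𝐓_k′, 𝐓_k″`, or the bounds.  Value = typed skeleton of the printed set manipulations + a located gap,
NOT summit progress.  Companion rows: cell `GAPS.md` G-B16-15 (this module), G-adv3-8, C-adv4-14, G-f2.4;
`DIVERGENCE.md` D-b02.13.
-/

namespace Literature.MathematicalPhysics.QuantumFieldTheory.Balaban1983to89.B16PostRGeom

open Literature.MathematicalPhysics.QuantumFieldTheory.Balaban1983to89.B14DomainGeom

variable {d : ℕ}

/-! ## A. Layer-algebra supplements (sup-metric cube layers of [I] p. 257, as typed in `…B14DomainGeom`) -/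

/-- `(X~⁻ⁿ)ᶜ = (Xᶜ)~ⁿ` — the two printed forms of a shrinking ([III] (3.20)). [folklore] -/
theorem compl_innerN (s n : ℕ) (Y : Set (Pt d)) : (innerN s n Y)ᶜ = enl s n Yᶜ := by
  rw [innerN_eq_compl_enl_compl, compl_compl]

/-- Shrinkings compose additively: `(X~⁻ᵇ)~⁻ᵃ = X~⁻⁽ᵃ⁺ᵇ⁾` (needs `0 < s`, as `enl_enl`). [folklore] -/
theorem innerN_innerN (s a b : ℕ) (hs : 0 < s) (X : Set (Pt d)) :
    innerN s a (innerN s b X) = innerN s (a + b) X := by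
  rw [innerN_eq_compl_enl_compl s a, compl_innerN s b X, enl_enl s b a hs, Nat.add_comm b a,
    ← innerN_eq_compl_enl_compl]

/-- Membership in `X~⁻⁽ᵃ⁺ᵇ⁾`: every cube within `a` layers lies in `X~⁻ᵇ`. [folklore] -/
theorem mem_innerN_add_iff (s a b : ℕ) (hs : 0 < s) (X : Set (Pt d)) (x : Pt d) :
    x ∈ innerN s (a + b) X ↔ ∀ y, IdxNear s a x y → y ∈ innerN s b X := by
  rw [← innerN_innerN s a b hs X]
  constructor
  · intro hx y hy
    exact hx.2 y hy
  · intro h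
    exact ⟨h x (IdxNear.refl s a x), h⟩

/-- `~ⁿ` distributes over arbitrary unions. [folklore] -/
theorem enl_iUnion (s n : ℕ) {ι : Type*} (X : ι → Set (Pt d)) :
    enl s n (⋃ i, X i) = ⋃ i, enl s n (X i) := by
  ext x
  simp only [enl, Set.mem_setOf_eq, Set.mem_iUnion]
  constructor
  · rintro ⟨y, ⟨i, hy⟩, hn⟩
    exact ⟨i, y, hy, hn⟩
  · rintro ⟨i, y, hy, hn⟩
    exact ⟨y, ⟨i, hy⟩, hn⟩

/-- `((X~⁻ᵇ)ᶜ)~ᵃ = (X~⁻⁽ᵃ⁺ᵇ⁾)ᶜ`: adding `a` layers to the complement of the `b`-interior reaches exactly the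
complement of the `(a+b)`-interior. [folklore] -/
theorem enl_compl_innerN (s a b : ℕ) (hs : 0 < s) (Y : Set (Pt d)) :
    enl s a (innerN s b Y)ᶜ = (innerN s (a + b) Y)ᶜ := by
  rw [compl_innerN s b Y, enl_enl s b a hs, Nat.add_comm b a, compl_innerN s (a + b) Y]

/-! ## B. The leading domain of (1.72) versus the retained large-field supports `Y_i~⁻⁶` (any candidate new domain) -/

/-- The region of the printed leading function `χ_k((Ω_k ∩ (Y₁ᶜ)~² ∩ ⋯ ∩ (Y_mᶜ)~²)~⁴)` of (1.72), for a candidate new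
k-th domain `Ωnew` and the class-2 components `Y i` (READING: as a point set; the plaquette-level support of `χ_k` adds
the `□~` of [IV] (1.3), not modelled). [cite: Balaban1989LargeFieldII, (1.72) p.379] -/
def leadingDomain (s : ℕ) (Ωnew : Set (Pt d)) {κ : Type*} (Y : κ → Set (Pt d)) : Set (Pt d) :=
  enl s 4 (Ωnew ∩ ⋂ i, enl s 2 (Y i)ᶜ)

/-- `((Yᶜ)~²)~⁴ = (Y~⁻⁶)ᶜ`: the printed cut followed by the printed four layers stops exactly at `Y~⁻⁶`, the support of
the retained large-field function `χ_k^c(Y_i~⁻⁶)` — collar width 6 = 4 + 2, the standard one. [folklore] -/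
theorem enl4_enl2_compl (s : ℕ) (hs : 0 < s) (Y : Set (Pt d)) : enl s 4 (enl s 2 Yᶜ) = (innerN s 6 Y)ᶜ := by
  have h := enl_compl_innerN s 4 2 hs Y
  rw [compl_innerN s 2 Y] at h
  simpa using h

/-- For ANY candidate new domain: the leading domain of (1.72) is disjoint from every `Y i~⁻⁶` (no cube is asked to be
both k-small by the leading function and inside the support of `χ_k^c(Y_i~⁻⁶)`). [folklore] -/
theorem leadingDomain_disjoint_innerN6 (s : ℕ) (hs : 0 < s) (Ωnew : Set (Pt d)) {κ : Type*}
    (Y : κ → Set (Pt d)) (i : κ) : Disjoint (leadingDomain s Ωnew Y) (innerN s 6 (Y i)) := by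
  have hsub : Ωnew ∩ ⋂ j, enl s 2 (Y j)ᶜ ⊆ enl s 2 (Y i)ᶜ := fun x hx => Set.mem_iInter.mp hx.2 i
  have h4 : leadingDomain s Ωnew Y ⊆ (innerN s 6 (Y i))ᶜ := by
    rw [← enl4_enl2_compl s hs (Y i)]
    exact enl_mono s 4 hsub
  exact Set.disjoint_left.mpr fun x hx hx6 => h4 hx hx6

/-! ## C. The local collar hypothesis and the printed rewriting `χ_k((Ω_k~⁴)ᶜ) ↦ χ_k(X_i~⁻⁶)` on a component -/

/-- `LocalCollar s Ω X`: within four layers of `X`, the complement of the (old) k-th domain `Ω` is exactly `X~⁻²` —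
the typed form of "`Λ_k = Ω_k~⁻²` near `X`, `X` a whole component of `Λ_kᶜ`, no other piece of `Ω_kᶜ` within 2 layers"
([III] (3.20) p. 269 and the 2MR_j separation p. 256; READING). [cite: Balaban1988Convergent, (3.20) p.269] -/
def LocalCollar (s : ℕ) (Ω X : Set (Pt d)) : Prop := Ωᶜ ∩ enl s 4 X = innerN s 2 X

namespace LocalCollar

variable {s : ℕ} {Ω X : Set (Pt d)}

/-- Under the local collar picture `X~⁻² ⊆ Ωᶜ`. [folklore] -/
theorem innerN2_subset_compl (h : LocalCollar s Ω X) : innerN s 2 X ⊆ Ωᶜ := by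
  intro x hx
  have hx' : x ∈ Ωᶜ ∩ enl s 4 X := by rw [h]; exact hx
  exact hx'.1

/-- Under the local collar picture the two outer layers `X \ X~⁻²` of the component lie in `Ω`. [folklore] -/
theorem diff_innerN2_subset (h : LocalCollar s Ω X) : X \ innerN s 2 X ⊆ Ω := by
  intro x hx
  by_contra hxΩ
  have hx' : x ∈ Ωᶜ ∩ enl s 4 X := ⟨hxΩ, subset_enl s 4 X hx.1⟩
  rw [h] at hx'
  exact hx.2 hx'

/-- Under the local collar picture `X~⁴ ⊆ Ω~⁴ ∪ X` (indeed `X~⁴ \ X ⊆ Ω`). [folklore] -/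
theorem enl4_subset (h : LocalCollar s Ω X) : enl s 4 X ⊆ enl s 4 Ω ∪ X := by
  intro y hy
  by_cases hyX : y ∈ X
  · exact Or.inr hyX
  · left
    have hyΩ : y ∈ Ω := by
      by_contra hyΩ
      have hy' : y ∈ Ωᶜ ∩ enl s 4 X := ⟨hyΩ, hy⟩
      rw [h] at hy'
      exact hyX (innerN_subset s 2 X hy')
    exact subset_enl s 4 Ω hyΩ

/-- **p. 378's rewriting.** Under the local collar picture `(Ω~⁴)ᶜ ∩ X = X~⁻⁶`: the part of a component `X` outside
`Ω_k~⁴` — where the decomposition of unity `1 = χ_k((Ω_k~⁴)ᶜ) + χ_k^c((Ω_k~⁴)ᶜ)` is inserted — is `X~⁻⁶`, as in the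
printed `χ_k(X_i~⁻⁶)`, `χ_k^c(Y_i~⁻⁶)` (6 = 4 + 2). [cite: Balaban1989LargeFieldII, p.378] -/
theorem compl_enl4_inter (hs : 0 < s) (h : LocalCollar s Ω X) : (enl s 4 Ω)ᶜ ∩ X = innerN s 6 X := by
  have key : ∀ x, x ∈ innerN s 6 X ↔ ∀ y, IdxNear s 4 x y → y ∈ innerN s 2 X := fun x => by
    simpa using mem_innerN_add_iff s 4 2 hs X x
  ext x
  constructor
  · rintro ⟨hxΩ, hxX⟩
    rw [key]
    intro y hy
    have hyX : y ∈ enl s 4 X := ⟨x, hxX, hy.symm⟩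
    have hyΩ : y ∉ Ω := fun hyΩ => hxΩ ⟨y, hyΩ, hy⟩
    have hy' : y ∈ Ωᶜ ∩ enl s 4 X := ⟨hyΩ, hyX⟩
    rw [h] at hy'
    exact hy'
  · intro hx
    refine ⟨?_, innerN_subset s 6 X hx⟩
    rintro ⟨y, hyΩ, hy⟩
    exact h.innerN2_subset_compl ((key x).mp hx y hy) hyΩ

/-- Under the local collar picture `Ω~⁴` and `X~⁻⁶` are disjoint (so `χ_k(Ω_k~⁴)·χ_k(X_i~⁻⁶)` is a product over
DISJOINT cube sets). [folklore] -/
theorem disjoint_enl4_innerN6 (hs : 0 < s) (h : LocalCollar s Ω X) : Disjoint (enl s 4 Ω) (innerN s 6 X) := by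
  rw [← h.compl_enl4_inter hs]
  exact Set.disjoint_left.mpr fun x hx hx' => hx'.1 hx

/-- Under the local collar picture `X = (X ∩ Ω~⁴) ∪ X~⁻⁶`. [folklore] -/
theorem self_eq_union (hs : 0 < s) (h : LocalCollar s Ω X) : X = (X ∩ enl s 4 Ω) ∪ innerN s 6 X := by
  rw [← h.compl_enl4_inter hs]
  ext x
  constructor
  · intro hx
    by_cases hx4 : x ∈ enl s 4 Ω
    · exact Or.inl ⟨hx, hx4⟩
    · exact Or.inr ⟨hx4, hx⟩
  · rintro (⟨hx, -⟩ | ⟨-, hx⟩) <;> exact hx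

end LocalCollar

/-! ## D. The effective new k-th domain `Ω′ = Ω ∪ ⋃ⱼ X j` and reading invariance -/

/-- **Support identity behind "combined with the function χ_k(Ω_k~⁴)".**  If every class-1 component has the local
collar picture, `(Ω ∪ ⋃ⱼ X j)~⁴ = Ω~⁴ ∪ ⋃ⱼ X j~⁻⁶`: the cubes constrained by `χ_k(Ω_k~⁴)·Πⱼ χ_k(X_j~⁻⁶)` are exactly
those of `Ω′~⁴` with `Ω′ = Ω_k ∪ ⋃ⱼ X_j`. [folklore] -/
theorem leading_support_eq (s : ℕ) (hs : 0 < s) (Ω : Set (Pt d)) {ι : Type*} (X : ι → Set (Pt d))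
    (hX : ∀ j, LocalCollar s Ω (X j)) :
    enl s 4 (Ω ∪ ⋃ j, X j) = enl s 4 Ω ∪ ⋃ j, innerN s 6 (X j) := by
  rw [enl_union, enl_iUnion]
  apply Set.Subset.antisymm
  · apply Set.union_subset Set.subset_union_left
    intro x hx
    obtain ⟨j, hj⟩ := Set.mem_iUnion.mp hx
    rcases (hX j).enl4_subset hj with h4 | hXj
    · exact Or.inl h4
    · by_cases hx4 : x ∈ enl s 4 Ω
      · exact Or.inl hx4
      · refine Or.inr (Set.mem_iUnion.mpr ⟨j, ?_⟩)
        rw [← (hX j).compl_enl4_inter hs]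
        exact ⟨hx4, hXj⟩
  · apply Set.union_subset Set.subset_union_left
    intro x hx
    obtain ⟨j, hj⟩ := Set.mem_iUnion.mp hx
    exact Or.inr (Set.mem_iUnion.mpr ⟨j, subset_enl s 4 (X j) (innerN_subset s 6 (X j) hj)⟩)

/-- **Reading (A)** of *"the new k-th domain"*: `Ωnew = Ω ∪ ⋃ⱼ X j`.  Then the printed cut `⋂ᵢ (Y iᶜ)~²` removes
nothing: `(Ω ∪ ⋃ⱼ X j) ∩ ⋂ᵢ (Y iᶜ)~² = Ω ∪ ⋃ⱼ X j` (class-2 components with the local collar picture, disjoint from the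
class-1 ones). [folklore] -/
theorem effective_of_readingA (s : ℕ) (Ω : Set (Pt d)) {ι κ : Type*} (X : ι → Set (Pt d))
    (Y : κ → Set (Pt d)) (hY : ∀ i, LocalCollar s Ω (Y i)) (hXY : ∀ j i, Disjoint (X j) (Y i)) :
    (Ω ∪ ⋃ j, X j) ∩ (⋂ i, enl s 2 (Y i)ᶜ) = Ω ∪ ⋃ j, X j := by
  apply Set.inter_eq_left.mpr
  intro x hx
  refine Set.mem_iInter.mpr fun i => ?_
  rw [← compl_innerN, Set.mem_compl_iff]
  intro hxi
  rcases hx with hxΩ | hxX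
  · exact (hY i).innerN2_subset_compl hxi hxΩ
  · obtain ⟨j, hj⟩ := Set.mem_iUnion.mp hxX
    exact Set.disjoint_left.mp (hXY j i) hj (innerN_subset s 2 (Y i) hxi)

/-- **Reading (B)** of *"the new k-th domain"*: `Ωnew = Ω ∪ Z`, all small components filled in
(`Z = ⋃ⱼ X j ∪ ⋃ᵢ Y i`).  Then the printed cut removes exactly the class-2 interiors and the result is the SAME set as
under reading (A): `(Ω ∪ ⋃ⱼ X j ∪ ⋃ᵢ Y i) ∩ ⋂ᵢ (Y iᶜ)~² = Ω ∪ ⋃ⱼ X j`. [folklore] -/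
theorem effective_of_readingB (s : ℕ) (Ω : Set (Pt d)) {ι κ : Type*} (X : ι → Set (Pt d))
    (Y : κ → Set (Pt d)) (hY : ∀ i, LocalCollar s Ω (Y i)) (hXY : ∀ j i, Disjoint (X j) (Y i)) :
    (Ω ∪ (⋃ j, X j) ∪ ⋃ i, Y i) ∩ (⋂ i, enl s 2 (Y i)ᶜ) = Ω ∪ ⋃ j, X j := by
  have hA := effective_of_readingA s Ω X Y hY hXY
  ext x
  constructor
  · rintro ⟨hx, hcut⟩
    rcases hx with hx | hxY
    · exact hx
    · obtain ⟨i, hi⟩ := Set.mem_iUnion.mp hxY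
      have hxi : x ∉ innerN s 2 (Y i) := by
        have hc := Set.mem_iInter.mp hcut i
        rwa [← compl_innerN, Set.mem_compl_iff] at hc
      exact Or.inl ((hY i).diff_innerN2_subset ⟨hi, hxi⟩)
  · intro hx
    rw [← hA] at hx
    exact ⟨Or.inl hx.1, hx.2⟩

/-- Corollary: under either reading the leading domain of (1.72) is `(Ω ∪ ⋃ⱼ X j)~⁴ = Ω~⁴ ∪ ⋃ⱼ X j~⁻⁶`, the region of
p. 378's *"χ_k(X_i~⁻⁶) … combined with the function χ_k(Ω_k~⁴)"* (reading (B) displayed; (A) is the same with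
`effective_of_readingA`). [folklore] -/
theorem leadingDomain_readingB (s : ℕ) (hs : 0 < s) (Ω : Set (Pt d)) {ι κ : Type*} (X : ι → Set (Pt d))
    (Y : κ → Set (Pt d)) (hX : ∀ j, LocalCollar s Ω (X j)) (hY : ∀ i, LocalCollar s Ω (Y i))
    (hXY : ∀ j i, Disjoint (X j) (Y i)) :
    leadingDomain s (Ω ∪ (⋃ j, X j) ∪ ⋃ i, Y i) Y = enl s 4 Ω ∪ ⋃ j, innerN s 6 (X j) := by
  unfold leadingDomain
  rw [effective_of_readingB s Ω X Y hY hXY, leading_support_eq s hs Ω X hX]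

/-! ## E. The new pair `(Ω′, Λ′)` at level k and the new large-field region (1.101) -/

/-- (2.1) at level k survives: `Λ ⊆ Ω` gives `Λ′ = Λ ∪ ⋃ⱼ X j ⊆ Ω ∪ ⋃ⱼ X j = Ω′`. [folklore] -/
theorem newLambda_subset_newOmega {Λ Ω : Set (Pt d)} (h : Λ ⊆ Ω) {ι : Type*} (X : ι → Set (Pt d)) :
    Λ ∪ ⋃ j, X j ⊆ Ω ∪ ⋃ j, X j :=
  Set.union_subset_union_left _ h

/-- **(1.101) as set algebra.**  With `Z = ⋃ⱼ X j ∪ ⋃ᵢ Y i ⊆ Λᶜ` (classes disjoint), the complement of the new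
small-field region `Λ′ = Λ ∪ ⋃ⱼ X j` is `(Λᶜ ∩ Zᶜ) ∪ ⋃ᵢ Y i` — the printed *"new large field region … Z_k ∪ ⋃ Y_i"* with
`Z_k` READ as the part of the old `Λ_kᶜ` outside `Z`. [cite: Balaban1989LargeFieldII, (1.101) p.390] -/
theorem compl_newLambda_eq {Λ Z : Set (Pt d)} {ι κ : Type*} (X : ι → Set (Pt d)) (Y : κ → Set (Pt d))
    (hZ : Z = (⋃ j, X j) ∪ ⋃ i, Y i) (hZΛ : Z ⊆ Λᶜ) (hXY : ∀ j i, Disjoint (X j) (Y i)) :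
    (Λ ∪ ⋃ j, X j)ᶜ = (Λᶜ ∩ Zᶜ) ∪ ⋃ i, Y i := by
  ext x
  simp only [Set.mem_compl_iff, Set.mem_union, Set.mem_inter_iff, Set.mem_iUnion, not_or, not_exists]
  constructor
  · rintro ⟨hxΛ, hxX⟩
    by_cases hxZ : x ∈ Z
    · rw [hZ] at hxZ
      rcases hxZ with hxX' | hxY
      · obtain ⟨j, hj⟩ := Set.mem_iUnion.mp hxX'
        exact absurd hj (hxX j)
      · exact Or.inr (Set.mem_iUnion.mp hxY)
    · exact Or.inl ⟨hxΛ, hxZ⟩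
  · rintro (⟨hxΛ, hxZ⟩ | ⟨i, hi⟩)
    · refine ⟨hxΛ, fun j hj => hxZ ?_⟩
      rw [hZ]
      exact Or.inl (Set.mem_iUnion.mpr ⟨j, hj⟩)
    · refine ⟨fun hxΛ => hZΛ ?_ hxΛ, fun j hj => Set.disjoint_left.mp (hXY j i) hj hi⟩
      rw [hZ]
      exact Or.inr (Set.mem_iUnion.mpr ⟨i, hi⟩)

/-- The collar of every class-2 component is the old one: `Ω′ ∩ Y i = Ω ∩ Y i` — so every layer margin the old pair
had at `Y_i` holds verbatim for the new pair. [folklore] -/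
theorem newOmega_inter_Y {Ω : Set (Pt d)} {ι κ : Type*} (X : ι → Set (Pt d)) (Y : κ → Set (Pt d))
    (hXY : ∀ j i, Disjoint (X j) (Y i)) (i : κ) : (Ω ∪ ⋃ j, X j) ∩ Y i = Ω ∩ Y i := by
  ext x
  simp only [Set.mem_inter_iff, Set.mem_union, Set.mem_iUnion]
  constructor
  · rintro ⟨hx | ⟨j, hj⟩, hi⟩
    · exact ⟨hx, hi⟩
    · exact absurd hi (Set.disjoint_left.mp (hXY j i) hj)
  · rintro ⟨hx, hi⟩
    exact ⟨Or.inl hx, hi⟩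

/-- The new collar region `Ω′ ∩ Λ′ᶜ` (where [III] p. 255's `S_k ⊇ Ω_k \ Ω_k~⁻¹` clause lives) is the old one with
the class-1 components removed. [folklore] -/
theorem newCollar_eq {Ω Λ : Set (Pt d)} {ι : Type*} (X : ι → Set (Pt d)) :
    (Ω ∪ ⋃ j, X j) ∩ (Λ ∪ ⋃ j, X j)ᶜ = (Ω ∩ Λᶜ) ∩ (⋃ j, X j)ᶜ := by
  ext x
  simp only [Set.mem_inter_iff, Set.mem_union, Set.mem_compl_iff, not_or]
  tauto

/-! ## F. Rectangular parallelepipeds: the local collar hypothesis for a box core ((2.3), [IV] p. 177) -/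

/-- A rectangular parallelepiped of side-`s` cubes: the points whose cube index lies in `[lo, hi]` coordinatewise.
[cite: Balaban1988Convergent, (2.3) p.255] -/
def box (s : ℕ) (lo hi : Pt d) : Set (Pt d) := {x | ∀ i, lo i ≤ cubeIdx s x i ∧ cubeIdx s x i ≤ hi i}

/-- `n` layers around a non-empty box form the box with index bounds `lo - n`, `hi + n`. [folklore] -/
theorem enl_box (s n : ℕ) (hs : 0 < s) (lo hi : Pt d) (hle : ∀ i, lo i ≤ hi i) :
    enl s n (box s lo hi) = box s (fun i => lo i - n) (fun i => hi i + n) := by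
  ext x
  constructor
  · rintro ⟨y, hy, hxy⟩ i
    have h1 := hy i
    have h2 := hxy i
    rw [abs_le] at h2
    simp only
    constructor <;> linarith [h1.1, h1.2, h2.1, h2.2]
  · intro hx
    let c : Pt d := fun i => max (lo i) (min (cubeIdx s x i) (hi i))
    have hc : cubeIdx s (fun i => (s : ℤ) * c i) = c := cubeIdx_corner s hs c
    refine ⟨fun i => (s : ℤ) * c i, fun i => ?_, fun i => ?_⟩
    · rw [hc]
      exact ⟨le_max_left _ _, max_le (hle i) (min_le_right _ _)⟩
    · rw [hc]
      have h1 := (hx i).1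
      have h2 := (hx i).2
      simp only at h1 h2
      show |cubeIdx s x i - max (lo i) (min (cubeIdx s x i) (hi i))| ≤ (n : ℤ)
      rcases le_total (cubeIdx s x i) (hi i) with hxh | hxh
      · rw [min_eq_left hxh]
        rcases le_total (lo i) (cubeIdx s x i) with hlx | hlx
        · rw [max_eq_right hlx, sub_self, abs_zero]
          positivity
        · rw [max_eq_left hlx, abs_le]
          constructor <;> linarith
      · rw [min_eq_right hxh, max_eq_right (hle i), abs_le]
        constructor <;> linarith

/-- Removing `n` layers from the box with bounds `lo - n`, `hi + n` gives back the box `[lo, hi]`. [folklore] -/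
theorem innerN_box (s n : ℕ) (hs : 0 < s) (lo hi : Pt d) :
    innerN s n (box s (fun i => lo i - n) (fun i => hi i + n)) = box s lo hi := by
  ext x
  constructor
  · rintro ⟨-, hall⟩ i
    -- move `n` cubes down, resp. up, in direction `i` and read off the bound there
    have probe : ∀ t : ℤ, |t| ≤ n →
        lo i - n ≤ cubeIdx s x i + t ∧ cubeIdx s x i + t ≤ hi i + n := by
      intro t ht
      let c : Pt d := fun i' => if i' = i then cubeIdx s x i + t else cubeIdx s x i'
      have hc : cubeIdx s (fun i' => (s : ℤ) * c i') = c := cubeIdx_corner s hs c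
      have hnear : IdxNear s n x (fun i' => (s : ℤ) * c i') := by
        intro i'
        rw [hc]
        by_cases hi' : i' = i
        · subst hi'
          simp only [c, if_pos rfl]
          rw [show cubeIdx s x i' - (cubeIdx s x i' + t) = -t by ring, abs_neg]
          exact ht
        · simp only [c, if_neg hi', sub_self, abs_zero]
          positivity
      have hy := hall _ hnear i
      rw [hc] at hy
      simpa [c] using hy
    have hup := (probe n (by simp)).2
    have hdn := (probe (-n) (by simp)).1
    constructor <;> linarith
  · intro hx
    refine ⟨fun i => ?_, fun y hy i => ?_⟩
    · have h1 := (hx i).1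
      have h2 := (hx i).2
      simp only
      constructor <;> linarith
    · have h1 := hx i
      have h2 := hy i
      rw [abs_le] at h2
      simp only
      constructor <;> linarith [h1.1, h1.2, h2.1, h2.2]

/-- A box is closed under "add `n` layers, then remove `n` layers": `(box~ⁿ)~⁻ⁿ = box`. [folklore] -/
theorem innerN_enl_box (s n : ℕ) (hs : 0 < s) (lo hi : Pt d) (hle : ∀ i, lo i ≤ hi i) :
    innerN s n (enl s n (box s lo hi)) = box s lo hi := by
  rw [enl_box s n hs lo hi hle, innerN_box s n hs lo hi]

/-- The local collar hypothesis holds for a component `X = W~²` whose core `W = Ωᶜ ∩ X~⁴` is a rectangular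
parallelepiped ((2.3): small components of `Z_j` are parallelepipeds; [IV] p. 177). [folklore] -/
theorem localCollar_of_box (s : ℕ) (hs : 0 < s) {Ω X W : Set (Pt d)} (lo hi : Pt d) (hle : ∀ i, lo i ≤ hi i)
    (hW : W = box s lo hi) (hX : X = enl s 2 W) (hΩ : Ωᶜ ∩ enl s 4 X = W) : LocalCollar s Ω X := by
  unfold LocalCollar
  rw [hΩ, hX, hW, innerN_enl_box s 2 hs lo hi hle]

end Literature.MathematicalPhysics.QuantumFieldTheory.Balaban1983to89.B16PostRGeom
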